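import Literature.NumberTheory.EllipticCurves.MultiplicativeRamifiedTorsionProofs
import Literature.NumberTheory.EllipticCurves.MultiplicativeUnipotentTorsionProofs
import HarnessLib

/-!
# Multiplicative reduction with `p ∣ v(Δ)`: the inertia group fixes the `p`-torsion
# (the unramified half of the Tate-curve criterion, from Kodaira–Néron over `K_v^nr`)

`Proofs` file (theorems only, no definitions, no named facts) in topic
`NumberTheory/EllipticCurves`, sibling of `MultiplicativeRamifiedTorsionProofs` (which proves the
*ramified* half: `p ∤ v(Δ)` ⟹ some inertia element moves a `p`-torsion point) and of
`MultiplicativeUnipotentTorsionProofs`.  The classical dictionary is the theory of the Tate curve: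
over `K_v^nr` one has `E[p] ≅ ⟨ζ_p, q^{1/p}⟩` with `v(q) = v(Δ_min)`, so the inertia group acts
trivially on `E[p]` iff `p ∣ v(Δ_min)` (Serre, *Propriétés galoisiennes des points d'ordre fini des
courbes elliptiques*, Invent. Math. 15 (1972), n° 1.12; Serre, Duke Math. J. 54 (1987), (4.1.12);
Diamond–Darmon–Taylor, *Fermat's Last Theorem*, Prop. 2.12(c); Silverman, *ATAEC*, V.4–V.5 and
Exercise 5.13(b)).  This file proves the unramified half **without the Tate curve**:

* `IsDedekindDomain.HeightOneSpectrum.forall_inertia_map_eq_of_multiplicative_of_dvd` — for an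
  elliptic curve over the completion `K_v` of a number field given by an integral equation `X₀`
  with nodal reduction (`c₄ ∈ 𝓞_v^×`) and `Δ(X₀) = u π^n` (`u ∈ 𝓞_v^×`, `π` a uniformiser,
  `n ≥ 1`), and a prime `p` with `v ∤ p` and `p ∣ n`: **every element of the inertia group
  `I_𝔐 ≤ Γ_{K_v}` fixes every `p`-torsion point of `X₀(K̄_v)`**;
* `WeierstrassCurve.smul_eq_of_mem_inertia_of_hasMultiplicativeReductionAt_of_dvd` — the same for
  `E(K̄_v)` (`localPoints`), reading the hypotheses `W.HasMultiplicativeReductionAt v` and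
  `p ∣ W.ordMinimalDiscriminant v` on the integral minimal model at `v`;
* `WeierstrassCurve.smul_eq_of_mem_inertia_of_hasMultiplicativeReductionAt_of_dvd_of_nsmul_eq_zero`,
  `WeierstrassCurve.smul_geomTorsion_eq_of_mem_inertia_of_hasMultiplicativeReductionAt_of_dvd` —
  the global form: the inertia group `I_𝔓 ≤ Gal(K̄/K)` of any prime `𝔓` above such a `v` acts
  trivially on `E[p] = E(K̄)[p]`, i.e. **`ρ̄_{E,p}` is unramified at `v`** (Serre 1987, (4.1.12):
  the primes `ℓ ≠ p` with `p ∣ v_ℓ(Δ)` do not divide `N(ρ̄_{E,p})`).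

## Proof

The setting and steps (1)–(3) of `exists_inertia_map_ne_of_multiplicative` are followed verbatim:
`J = X₀ ⊗ 𝒪ⁿʳ` over the valuation ring `𝒪ⁿʳ` of `K_v^nr = (K̄_v)^{I_𝔐}` (a Henselian discrete
valuation ring) has a split node and a Tate normal form with exponent `n`, so
`[J(K_v^nr) : E₀] = n` (Silverman, *ATAEC*, Cor. IV.9.2(d); tree
`LocalIndex.index_eq_of_tateNormalForm`); `W₀ = J ⊗ 𝒪_w` is an `𝒪_w`-model of `X₀ ⊗ K̄_v` whose
reduction is a node, with node map `r : E₀(K̄_v) ↠ k̄^×` of kernel `E₁(K̄_v)` (*AEC* VII.2.1,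
III.2.5, surjective by Hensel: `exists_addMonoidHom_units_of_node_of_isAlgClosed`); `E₀(J)` maps
into `E₀(W₀)`, and (new, the converse for `K_v^nr`-points) a `K_v^nr`-point lying in `E₀(W₀)`
lies in `E₀(J)`.  Then:

4. *(Cauchy)* as `p ∣ n` there is `R ∈ J(K_v^nr)` whose class modulo `E₀` has order `p`:
   `R ∉ E₀`, `pR ∈ E₀`;
5. `pR = pS` with `S ∈ E₀(W₀)` **fixed by `I_𝔐`**
   (`WeierstrassCurve.exists_smul_eq_of_hasNonsingularReduction_of_node`: divide `r(pR)` in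
   `k̄^×`, lift, and divide the difference inside the `p`-divisible group `E₁(K̄_v)` —
   *AEC* IV.3.2(b)/VII.2.2, tree `exists_zsmul_eq_of_one_lt_val`; for `σ ∈ I_𝔐`, `σS - S ∈ E₀` is
   killed by `p` and has reduction `Õ`, inertia acting trivially on reductions
   (`reducePoint_congrEquiv_map_eq`), hence lies in `E₁`, which has no `p`-torsion, *AEC*
   VII.3.1(a)); so `P₁ = R - S` is a `p`-torsion point fixed by `I_𝔐` (the coordinates of `R` lie
   in `K_v^nr`) and **not** in `E₀`;
6. a non-zero `p`-torsion point `T ∈ E₀(W₀)` fixed by `I_𝔐`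
   (`WeierstrassCurve.exists_torsion_hasNonsingularReduction_of_node`, the Hensel step of
   `MultiplicativeUnipotentTorsionProofs`);
7. *(counting, `Literature.NumberTheory.EllipticCurves.addSubgroup_le_of_card_eq_sq`)* the subgroup
   of `X₀(K̄_v)[p]` (order `p²`, `card_torsionPoints_eq_sq`) fixed by `σ ∈ I_𝔐` contains `T` and
   `P₁`; its order is `p` or `p²`, and in the first case it would be `ℤT ⊆ E₀ ∌ P₁`; so it is
   everything.

In Tate-curve language, step 5 says that the Kummer cocycle of `q` on `I_𝔐` is trivial when
`p ∣ v(q)`; here the component group `J(K_v^nr)/E₀` of order `n` (Kodaira–Néron) replaces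
`v(q) = n`.

## References

* [SerreInventiones1972] J.-P. Serre, *Propriétés galoisiennes des points d'ordre fini des courbes
  elliptiques*, Invent. Math. 15 (1972), n° 1.12 (courbes de Tate).
* [Serre1987] J.-P. Serre, *Sur les représentations modulaires de degré 2 de Gal(ℚ̄/ℚ)*, Duke
  Math. J. 54 (1987), §4.1, (4.1.12).
* [DarmonDiamondTaylor1995] H. Darmon, F. Diamond, R. Taylor, *Fermat's Last Theorem*, Prop. 2.12(c).
* [SilvermanATAEC1994] J. H. Silverman, *Advanced Topics in the Arithmetic of Elliptic Curves*,
  GTM 151 (1994): Cor. IV.9.2(d) (PDF p. 340 of the held copy), V.4–V.5, Exercise 5.13(b)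
  (PDF p. 416).
* [SilvermanAEC2009] J. H. Silverman, *The Arithmetic of Elliptic Curves*, 2nd ed. (2009): VII.2.1,
  VII.2.2, VII.3.1, III.2.5, IV.3.2(b), VIII.§1.
* [NeukirchANT1999] J. Neukirch, *Algebraic Number Theory*, Springer 1999, Ch. II (9.6).

## Design

No definitions; theorems only; `noncomputable section`; `open scoped Classical NNReal`; one
universe `u`.  The spectral valuation is quantified with `hw` as in the sibling files, whose setting
is followed verbatim; `set_option maxHeartbeats` is raised for the main local theorem (many
coercions), as there.  Deliberate dot-notation extensions of Mathlib's `WeierstrassCurve` and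
`IsDedekindDomain.HeightOneSpectrum` namespaces, as in the sibling files.
-/

noncomputable section

open scoped Classical NNReal
open NumberField IsDedekindDomain Field Polynomial IsLocalRing

universe u


/-! ## A counting lemma in a group of order `p²` -/

namespace Literature.NumberTheory.EllipticCurves

/-- **Two independent elements generate a group of order `p²`.**  Let `H` be a subgroup of order
`p²` of an abelian group, `T, P ∈ H` with `T ≠ 0`, `p • T = 0`, and suppose `T` lies in a subgroup
`E` which does not contain `P`.  Then every subgroup `F` containing `T` and `P` contains `H`
(`F ∩ H` has order `p` or `p²`; in the first case it is `ℤ T ⊆ E`, which misses `P`). [folklore] -/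
theorem addSubgroup_le_of_card_eq_sq {G : Type*} [AddCommGroup G] {p : ℕ} (hp : p.Prime)
    {H E F : AddSubgroup G} (hH : Nat.card H = p ^ 2) {T P : G} (hTH : T ∈ H) (hPH : P ∈ H)
    (hT0 : T ≠ 0) (hpT : p • T = 0) (hTE : T ∈ E) (hPE : P ∉ E) (hTF : T ∈ F) (hPF : P ∈ F) :
    H ≤ F := by
  haveI : Fact p.Prime := ⟨hp⟩
  haveI hHfin : Finite H := Nat.finite_of_card_ne_zero (by rw [hH]; exact pow_ne_zero _ hp.ne_zero)
  set F' : AddSubgroup H := F.addSubgroupOf H with hF'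
  set T' : H := ⟨T, hTH⟩ with hT'
  set P' : H := ⟨P, hPH⟩ with hP'
  have hT'F : T' ∈ F' := by rw [hF', AddSubgroup.mem_addSubgroupOf]; exact hTF
  have hP'F : P' ∈ F' := by rw [hF', AddSubgroup.mem_addSubgroupOf]; exact hPF
  have hordT' : addOrderOf T' = p := by
    refine addOrderOf_eq_prime ?_ ?_
    · exact Subtype.ext (by simpa using hpT)
    · exact fun h ↦ hT0 (congrArg Subtype.val h)
  have hcardF' : Nat.card F' ∣ p ^ 2 := hH ▸ AddSubgroup.card_addSubgroup_dvd_card F'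
  have hpF' : p ∣ Nat.card F' := hordT' ▸ AddSubgroup.addOrderOf_dvd_natCard F' hT'F
  obtain ⟨k, hk, hcard⟩ := (Nat.dvd_prime_pow hp).mp hcardF'
  interval_cases k
  · rw [hcard, pow_zero, Nat.dvd_one] at hpF'
    exact absurd hpF' hp.one_lt.ne'
  · -- `F' = ℤ T'`, so `P ∈ ℤ T ⊆ E`: contradiction
    exfalso
    have hle : AddSubgroup.zmultiples T' ≤ F' := AddSubgroup.zmultiples_le.mpr hT'F
    haveI : Finite F' := Nat.finite_of_card_ne_zero (by rw [hcard]; exact pow_ne_zero _ hp.ne_zero)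
    have heq : AddSubgroup.zmultiples T' = F' :=
      AddSubgroup.eq_of_le_of_card_ge hle (by rw [hcard, pow_one, Nat.card_zmultiples, hordT'])
    have hPz : P' ∈ AddSubgroup.zmultiples T' := heq ▸ hP'F
    obtain ⟨m, hm⟩ := AddSubgroup.mem_zmultiples_iff.mp hPz
    have hPm : P = m • T := by
      have := congrArg Subtype.val hm
      simpa using this.symm
    exact hPE (hPm ▸ E.zsmul_mem hTE m)
  · -- `F' = H`
    have htop : F' = ⊤ := (AddSubgroup.card_eq_iff_eq_top F').mp (by rw [hcard, hH])
    intro Z hZ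
    have : (⟨Z, hZ⟩ : H) ∈ F' := htop ▸ AddSubgroup.mem_top _
    rw [hF', AddSubgroup.mem_addSubgroupOf] at this
    exact this

end Literature.NumberTheory.EllipticCurves

/-! ## Division by `p` inside `E₀`, and a fixed `p`-torsion point of `E₀`, over `K̄_v` -/

namespace WeierstrassCurve

open Literature.NumberTheory.EllipticCurves

variable {L : Type u} [Field L] [IsAlgClosed L] {w : Valuation L ℝ≥0}
  (W₀ : WeierstrassCurve w.integer) {F₀ : Type*} [Field F₀] [Algebra F₀ L]
  {X : WeierstrassCurve F₀} (hX : X.baseChange L = W₀.baseChange L)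

/-- **`p`-division inside `E₀` by a point fixed together with its `p`-multiple.**  Let `(L, w)`
be an algebraically closed valued field, `W₀` an `𝒪_w`-Weierstrass equation whose reduction is a
node, given with the node homomorphism `r : E₀(L) ↠ k^×` with kernel `E₁(L)` (Silverman, *AEC*
VII.2.1 with III.2.5; `exists_addMonoidHom_units_of_node_of_isAlgClosed`), `X` an equation over a
subfield `F₀` with `X_L = (W₀)_L` and `X_L` elliptic, and `p` a prime with `|p| = 1`.  Then every
`Y ∈ E₀(L)` is `p • S` for some `S ∈ E₀(L)` (divide `r(Y)` in `k^×`, lift by surjectivity, and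
divide the difference in the `p`-divisible kernel of reduction `E₁(L)`, *AEC* IV.3.2(b)/VII.2.2,
`exists_zsmul_eq_of_one_lt_val`), and any such `S` is fixed by every `F₀`-automorphism `σ` of `L`
acting like an element of the inertia group (a `w`-isometry moving integers within their residue
class) which fixes `Y`: `σS - S ∈ E₀` is killed by `p` and reduces to `Õ` (inertia acts trivially on
the reduction, `reducePoint_congrEquiv_map_eq`), so lies in `E₁(L)`, which has no `p`-torsion
(*AEC* VII.3.1(a)). [cite: SilvermanAEC2009, VII.2 Prop. 2.1, VII.2.2, VII.3 Prop. 3.1(a), VIII.§1] -/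
theorem exists_smul_eq_of_hasNonsingularReduction_of_node [(X.baseChange L).IsElliptic]
    (r : W₀.nonsingularReductionSubgroup (Valuation.integer.integers w) →+
      Additive (IsLocalRing.ResidueField w.integer)ˣ)
    (hrsurj : Function.Surjective r)
    (hr : ∀ P, r P = 0 ↔ W₀.ReducesToZero (P : (W₀.baseChange L).toAffine.Point))
    {p : ℕ} (hp : p.Prime) (hpw : w (p : L) = 1)
    (Y : (X.baseChange L).toAffine.Point)
    (hY : W₀.HasNonsingularReduction (Affine.Point.congrEquiv hX Y)) :
    ∃ S : (X.baseChange L).toAffine.Point,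
      W₀.HasNonsingularReduction (Affine.Point.congrEquiv hX S) ∧ p • S = Y ∧
        ∀ σ : L →ₐ[F₀] L, (∀ z, w (σ z) = w z) → (∀ z, w z ≤ 1 → w (σ z - z) < 1) →
          Affine.Point.map σ Y = Y → Affine.Point.map σ S = S := by
  have hv0 : w.Integers w.integer := Valuation.integer.integers w
  haveI hint : (X.baseChange L).IsIntegral w.integer := ⟨W₀, hX⟩
  have hpw' : w ((p : ℤ) : L) = 1 := by rw [Int.cast_natCast]; exact hpw
  set e := Affine.Point.congrEquiv hX with he
  -- a `p`-th root `c` of `r(Y)` in `k^×` and a lift `S₀ ∈ E₀`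
  haveI := isAlgClosed_residueField_integer w
  set Y' : W₀.nonsingularReductionSubgroup hv0 := ⟨e Y, hY⟩ with hY'
  set u : (IsLocalRing.ResidueField w.integer)ˣ := Additive.toMul (r Y') with hu
  obtain ⟨c₀, hc₀⟩ := IsAlgClosed.exists_pow_nat_eq (u : IsLocalRing.ResidueField w.integer) hp.pos
  have hc₀0 : c₀ ≠ 0 := by
    rintro rfl
    rw [zero_pow hp.ne_zero] at hc₀
    exact u.ne_zero hc₀.symm
  set c : (IsLocalRing.ResidueField w.integer)ˣ := Units.mk0 c₀ hc₀0 with hc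
  have hcu : c ^ p = u := Units.ext (by rw [Units.val_pow_eq_pow_val, hc, Units.val_mk0, hc₀])
  have hcp : p • Additive.ofMul c = r Y' := by
    rw [← ofMul_pow, hcu, hu, ofMul_toMul]
  obtain ⟨P₀, hP₀⟩ := hrsurj (Additive.ofMul c)
  set S₀ : (X.baseChange L).toAffine.Point :=
    e.symm (P₀ : (W₀.baseChange L).toAffine.Point) with hS₀
  have heS₀ : e S₀ = P₀ := by rw [hS₀, AddEquiv.apply_symm_apply]
  have hS₀E₀ : W₀.HasNonsingularReduction (e S₀) := by rw [heS₀]; exact P₀.2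
  -- `Y - p • S₀ ∈ E₁`
  have hdiffE₀ : W₀.HasNonsingularReduction (e (Y - p • S₀)) := by
    rw [map_sub, map_nsmul]
    exact (W₀.nonsingularReductionSubgroup hv0).sub_mem hY
      ((W₀.nonsingularReductionSubgroup hv0).nsmul_mem hS₀E₀ p)
  have hker : W₀.ReducesToZero (e (Y - p • S₀)) := by
    have h1 : r ⟨e (Y - p • S₀), hdiffE₀⟩ = 0 := by
      have hsplit : (⟨e (Y - p • S₀), hdiffE₀⟩ : W₀.nonsingularReductionSubgroup hv0) =
          Y' - p • ⟨e S₀, hS₀E₀⟩ :=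
        Subtype.ext (by
          change e (Y - p • S₀) = e Y - p • e S₀
          rw [map_sub, map_nsmul])
      have hS₀P₀ : (⟨e S₀, hS₀E₀⟩ : W₀.nonsingularReductionSubgroup hv0) = P₀ := Subtype.ext heS₀
      rw [hsplit, map_sub, map_nsmul, hS₀P₀, hP₀, hcp, sub_self]
    exact (hr _).mp h1
  -- divide `Y - p • S₀` by `p` inside `E₁`
  obtain ⟨Q₁, hQ₁E₁, hQ₁⟩ : ∃ Q₁ : (X.baseChange L).toAffine.Point,
      W₀.ReducesToZero (e Q₁) ∧ p • Q₁ = Y - p • S₀ := by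
    rcases hT : (Y - p • S₀) with _ | ⟨x, y, hxy⟩
    · exact ⟨0, by rw [map_zero]; exact reducesToZero_zero, by rw [smul_zero, Affine.Point.zero_def]⟩
    · have hx : 1 < w x := by
        rw [hT, he, Affine.Point.congrEquiv_some, reducesToZero_some_iff, not_mem_range_iff hv0] at hker
        exact hker
      obtain ⟨x', y', hxy', hx', hdiv⟩ := exists_zsmul_eq_of_one_lt_val (w := w)
        (V := X.baseChange L) (m := (p : ℤ)) hpw' hxy hx
      refine ⟨.some x' y' hxy', ?_, ?_⟩
      · rw [he, Affine.Point.congrEquiv_some, reducesToZero_some_iff, not_mem_range_iff hv0]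
        exact hx'
      · rw [← natCast_zsmul]; exact hdiv
  set S := S₀ + Q₁ with hS
  have hSE₀ : W₀.HasNonsingularReduction (e S) := by
    rw [hS, map_add]
    exact (W₀.nonsingularReductionSubgroup hv0).add_mem hS₀E₀ hQ₁E₁.hasNonsingularReduction
  have hpS : p • S = Y := by rw [hS, smul_add, hQ₁, add_sub_cancel]
  refine ⟨S, hSE₀, hpS, fun σ hσ₁ hσ₂ hσY ↦ ?_⟩
  -- `σ S - S ∈ E₀ ∩ ker (reduction) = E₁`, and is killed by `p`
  have hσSE₀ : W₀.HasNonsingularReduction (e (Affine.Point.map σ S)) :=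
    (W₀.hasNonsingularReduction_congrEquiv_map_iff hX σ hσ₁ hσ₂ S).mpr hSE₀
  have hred : W₀.reducePoint (e (Affine.Point.map σ S)) = W₀.reducePoint (e S) :=
    W₀.reducePoint_congrEquiv_map_eq hX σ hσ₁ hσ₂ S
  have hDE₀ : W₀.HasNonsingularReduction (e (Affine.Point.map σ S) - e S) := by
    rw [sub_eq_add_neg]; exact hσSE₀.add hv0 hSE₀.neg
  have hDred : W₀.reducePoint (e (Affine.Point.map σ S) - e S) = 0 := by
    rw [sub_eq_add_neg, reducePoint_add hv0 hσSE₀ hSE₀.neg, reducePoint_neg hv0.hom_inj, hred,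
      add_neg_cancel]
  have hD0 : W₀.ReducesToZero (e (Affine.Point.map σ S) - e S) :=
    (reducePoint_eq_zero_iff hv0 hDE₀).mp hDred
  have hpD : (p : ℤ) • (e (Affine.Point.map σ S) - e S) = 0 := by
    rw [← map_sub, ← map_zsmul, natCast_zsmul, smul_sub, ← map_nsmul, hpS, hσY, sub_self, map_zero]
  have h0 := hD0.eq_zero_of_zsmul_eq_zero W₀ hpw' hpD
  rw [sub_eq_zero] at h0
  exact e.injective h0

/-- **A non-zero `p`-torsion point of `E₀` fixed by the inertia group** (the step "a fixed point of
order `p` in `E₀` from Hensel" of `smul_smul_sub_eq_of_mem_inertia_of_hasMultiplicativeReductionAt`,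
Silverman *AEC* VII.2.1, VII.3.1): in the situation of
`exists_smul_eq_of_hasNonsingularReduction_of_node`, a preimage of a primitive `p`-th root of unity
under `r`, corrected inside `E₁(L)` to be killed by `p`, is a point `T ≠ O` of `E₀(L)` with
`p T = O`, fixed by every inertia-like `F₀`-automorphism of `L` (inertia does not move reductions,
and reduction is injective on the prime-to-`p` torsion of `E₀`, *AEC* VII.3.1(b)).
[cite: SilvermanAEC2009, VII.2 Prop. 2.1, VII.3 Prop. 3.1, VIII.§1] -/
theorem exists_torsion_hasNonsingularReduction_of_node [(X.baseChange L).IsElliptic]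
    (r : W₀.nonsingularReductionSubgroup (Valuation.integer.integers w) →+
      Additive (IsLocalRing.ResidueField w.integer)ˣ)
    (hrsurj : Function.Surjective r)
    (hr : ∀ P, r P = 0 ↔ W₀.ReducesToZero (P : (W₀.baseChange L).toAffine.Point))
    {p : ℕ} (hp : p.Prime) (hpw : w (p : L) = 1) :
    ∃ T : (X.baseChange L).toAffine.Point, T ≠ 0 ∧ p • T = 0 ∧
      W₀.HasNonsingularReduction (Affine.Point.congrEquiv hX T) ∧
        ∀ σ : L →ₐ[F₀] L, (∀ z, w (σ z) = w z) → (∀ z, w z ≤ 1 → w (σ z - z) < 1) →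
          Affine.Point.map σ T = T := by
  have hv0 : w.Integers w.integer := Valuation.integer.integers w
  haveI hint : (X.baseChange L).IsIntegral w.integer := ⟨W₀, hX⟩
  have hpw' : w ((p : ℤ) : L) = 1 := by rw [Int.cast_natCast]; exact hpw
  set e := Affine.Point.congrEquiv hX with he
  haveI := isAlgClosed_residueField_integer w
  -- `p ≠ 0` in the residue field
  have hpk : ((p : ℕ) : IsLocalRing.ResidueField w.integer) ≠ 0 := by
    have hpw'' : w (algebraMap w.integer L (p : w.integer)) = 1 := by
      rw [map_natCast]; exact hpw
    have h1 : IsLocalRing.residue w.integer (p : w.integer) ≠ 0 :=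
      (v_algebraMap_eq_one_iff hv0 _).mp hpw''
    simpa using h1
  haveI : NeZero ((p : ℕ) : IsLocalRing.ResidueField w.integer) := ⟨hpk⟩
  -- a primitive `p`-th root of unity `b` and a lift `S₀ ∈ E₀`
  obtain ⟨b₀, hb₀⟩ := HasEnoughRootsOfUnity.exists_primitiveRoot (IsLocalRing.ResidueField w.integer) p
  have hb₀unit : IsUnit b₀ := hb₀.isUnit hp.ne_zero
  set b : (IsLocalRing.ResidueField w.integer)ˣ := hb₀unit.unit with hbdef
  have hb : IsPrimitiveRoot b p := by
    refine IsPrimitiveRoot.of_map_of_injective (f := Units.coeHom _) ?_ Units.val_injective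
    rw [Units.coeHom_apply, hbdef, IsUnit.unit_spec]
    exact hb₀
  have hbp : p • Additive.ofMul b = 0 := by rw [← ofMul_pow, hb.pow_eq_one, ofMul_one]
  have hb1 : Additive.ofMul b ≠ 0 := by
    intro h0
    have : b = 1 := by simpa using h0
    exact hb.ne_one hp.one_lt this
  obtain ⟨P₀, hP₀⟩ := hrsurj (Additive.ofMul b)
  set S₀ : (X.baseChange L).toAffine.Point :=
    e.symm (P₀ : (W₀.baseChange L).toAffine.Point) with hS₀
  have heS₀ : e S₀ = P₀ := by rw [hS₀, AddEquiv.apply_symm_apply]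
  have hS₀E₀ : W₀.HasNonsingularReduction (e S₀) := by rw [heS₀]; exact P₀.2
  -- `p • S₀ ∈ E₁`
  have hpS₀E₀ : W₀.HasNonsingularReduction (e (p • S₀)) := by
    rw [map_nsmul]; exact (W₀.nonsingularReductionSubgroup hv0).nsmul_mem hS₀E₀ p
  have hker : W₀.ReducesToZero (e (p • S₀)) := by
    have h1 : r ⟨e (p • S₀), hpS₀E₀⟩ = 0 := by
      have hsplit : (⟨e (p • S₀), hpS₀E₀⟩ : W₀.nonsingularReductionSubgroup hv0) =
          p • ⟨e S₀, hS₀E₀⟩ :=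
        Subtype.ext (by change e (p • S₀) = p • e S₀; rw [map_nsmul])
      rw [hsplit, map_nsmul]
      have : (⟨e S₀, hS₀E₀⟩ : W₀.nonsingularReductionSubgroup hv0) = P₀ := Subtype.ext heS₀
      rw [this, hP₀, hbp]
    exact (hr _).mp h1
  -- divide `p • S₀` by `p` inside `E₁`
  obtain ⟨Q₁, hQ₁E₁, hQ₁⟩ : ∃ Q₁ : (X.baseChange L).toAffine.Point,
      W₀.ReducesToZero (e Q₁) ∧ p • Q₁ = p • S₀ := by
    rcases hT : (p • S₀) with _ | ⟨x, y, hxy⟩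
    · exact ⟨0, by rw [map_zero]; exact reducesToZero_zero, by rw [smul_zero, Affine.Point.zero_def]⟩
    · have hx : 1 < w x := by
        rw [hT, he, Affine.Point.congrEquiv_some, reducesToZero_some_iff, not_mem_range_iff hv0] at hker
        exact hker
      obtain ⟨x', y', hxy', hx', hdiv⟩ := exists_zsmul_eq_of_one_lt_val (w := w)
        (V := X.baseChange L) (m := (p : ℤ)) hpw' hxy hx
      refine ⟨.some x' y' hxy', ?_, ?_⟩
      · rw [he, Affine.Point.congrEquiv_some, reducesToZero_some_iff, not_mem_range_iff hv0]
        exact hx'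
      · rw [← natCast_zsmul]; exact hdiv
  set T := S₀ - Q₁ with hTdef
  have hTE₀ : W₀.HasNonsingularReduction (e T) := by
    rw [hTdef, map_sub]
    exact (W₀.nonsingularReductionSubgroup hv0).sub_mem hS₀E₀ hQ₁E₁.hasNonsingularReduction
  have hpT : p • T = 0 := by rw [hTdef, smul_sub, hQ₁, sub_self]
  -- `r(T) = b ≠ 1`, so `T ≠ O`
  have hrT : r ⟨e T, hTE₀⟩ = Additive.ofMul b := by
    have hsplit : (⟨e T, hTE₀⟩ : W₀.nonsingularReductionSubgroup hv0) =
        ⟨e S₀, hS₀E₀⟩ - ⟨e Q₁, hQ₁E₁.hasNonsingularReduction⟩ :=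
      Subtype.ext (by change e (S₀ - Q₁) = e S₀ - e Q₁; rw [map_sub])
    rw [hsplit, map_sub, (hr ⟨e Q₁, hQ₁E₁.hasNonsingularReduction⟩).mpr hQ₁E₁, sub_zero, ← hP₀]
    congr 1
    exact Subtype.ext heS₀
  have hT0 : T ≠ 0 := by
    intro h0
    apply hb1
    rw [← hrT]
    have : (⟨e T, hTE₀⟩ : W₀.nonsingularReductionSubgroup hv0) = 0 :=
      Subtype.ext (by change e T = 0; rw [h0, map_zero])
    rw [this, map_zero]
  refine ⟨T, hT0, hpT, hTE₀, fun σ hσ₁ hσ₂ ↦ ?_⟩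
  -- `T^σ = T`: same reduction, both in `E₀[p]`
  have hσTE₀ : W₀.HasNonsingularReduction (e (Affine.Point.map σ T)) :=
    (W₀.hasNonsingularReduction_congrEquiv_map_iff hX σ hσ₁ hσ₂ T).mpr hTE₀
  have hred : W₀.reducePoint (e (Affine.Point.map σ T)) = W₀.reducePoint (e T) :=
    W₀.reducePoint_congrEquiv_map_eq hX σ hσ₁ hσ₂ T
  have hpT' : (p : ℤ) • e T = 0 := by rw [← map_zsmul, natCast_zsmul, hpT, map_zero]
  have hpσT : (p : ℤ) • e (Affine.Point.map σ T) = 0 := by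
    rw [← map_zsmul, natCast_zsmul, ← map_nsmul, hpT, map_zero, map_zero]
  exact e.injective (W₀.eq_of_reducePoint_eq_of_zsmul_eq_zero hpw' hσTE₀ hTE₀ hpσT hpT' hred)

end WeierstrassCurve

/-! ## The local theorem: `p ∣ v(Δ)` at a multiplicative place `v ∤ p` ⟹ inertia fixes `E[p]` -/

namespace IsDedekindDomain.HeightOneSpectrum

open Literature.NumberTheory.EllipticCurves Literature.NumberTheory.EllipticCurves.LocalIndex
  Literature.NumberTheory.GaloisRepresentations
  Literature.NumberTheory.GaloisRepresentations.IsNonarchimedeanLocalField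
  Literature.NumberTheory.DiophantineGeometry Literature.NumberTheory.DiophantineGeometry.TateAlgorithm

variable {K : Type u} [Field K] [NumberField K] {v : HeightOneSpectrum (𝓞 K)}
  {w : Valuation (AlgebraicClosure (v.adicCompletion K)) ℝ≥0}
  (hw : ∀ x, (w x : ℝ) = spectralNorm (v.adicCompletion K) (AlgebraicClosure (v.adicCompletion K)) x)

include hw in
set_option maxHeartbeats 4000000 in
/-- **Multiplicative reduction with `p ∣ v(Δ)`: the inertia group fixes the `p`-torsion** (the
unramified half of the Tate-curve criterion: at a multiplicative place `v ∤ p`, `ρ̄_{E,p}` is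
unramified iff `p ∣ v(Δ_min)`; Serre, *Propriétés galoisiennes…*, Invent. Math. 15 (1972), n° 1.12,
and Silverman, *ATAEC*, V.4–V.5 with Exercise 5.13(b): over `K_v^nr`, `E[p] = ⟨ζ_p, q^{1/p}⟩` with
`v(q) = v(Δ_min)`).  Let `K` be a number field, `v` a finite place, `X₀` a Weierstrass equation over
`𝓞_v` with `c₄(X₀) ∈ 𝓞_v^×` and `Δ(X₀) = u π^n` (`u ∈ 𝓞_v^×`, `π` a uniformiser, `n ≥ 1`), `p` a
prime with `v ∤ p` and `p ∣ n`, and `𝔐` the prime of `\bar 𝓞_v ⊆ K̄_v` above `𝓂_v`.  Then every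
element of the inertia group `I_𝔐 ≤ Γ_{K_v}` fixes every `P ∈ X₀(K̄_v)` with `pP = O`.

Proof **without the Tate curve**, from Kodaira–Néron over `K_v^nr` (as in the sibling
`exists_inertia_map_ne_of_multiplicative`, whose setting is followed verbatim): on `J = X₀ ⊗ 𝒪ⁿʳ`
(`𝒪ⁿʳ` the valuation ring of `K_v^nr = (K̄_v)^{I_𝔐}`, Henselian with algebraically closed residue
field, split node) `[J(K_v^nr) : E₀] = n` (`LocalIndex.index_eq_of_tateNormalForm`, Silverman *ATAEC*
Cor. IV.9.2(d)); as `p ∣ n`, Cauchy's theorem gives `R ∈ J(K_v^nr)` with `R ∉ E₀`, `pR ∈ E₀`.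
Over `K̄_v` (model `W₀ = J ⊗ 𝒪_w`, node map `r : E₀ ↠ k̄^×` with kernel `E₁`) `pR = pS` with
`S ∈ E₀` fixed by `I_𝔐` (`exists_smul_eq_of_hasNonsingularReduction_of_node`), so `P₁ = R - S` is a
`p`-torsion point fixed by `I_𝔐` and not in `E₀`; with a non-zero `I_𝔐`-fixed `p`-torsion point
`T ∈ E₀` (`exists_torsion_hasNonsingularReduction_of_node`) it generates `X₀(K̄_v)[p] ≅ (ℤ/p)²`
(`addSubgroup_le_of_card_eq_sq`, `card_torsionPoints_eq_sq`), which is therefore fixed by `I_𝔐`.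
[cite: SerreInventiones1972, n° 1.12] [cite: SilvermanATAEC1994, Cor. IV.9.2(d) (PDF p. 340), V.4–V.5 and Exercise 5.13(b) (PDF p. 416)]
[cite: SilvermanAEC2009, Prop. VII.2.1, Prop. VII.3.1, Prop. III.2.5] -/
theorem forall_inertia_map_eq_of_multiplicative_of_dvd
    (X₀ : WeierstrassCurve (v.adicCompletionIntegers K)) {u π : v.adicCompletionIntegers K}
    (hu : IsUnit u) (hπ : Irreducible π) {n : ℕ} (hn : 1 ≤ n) (hΔ : X₀.Δ = u * π ^ n)
    (hc₄ : X₀.c₄ ∉ maximalIdeal (v.adicCompletionIntegers K))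
    {p : ℕ} (hp : p.Prime) (hpv : (p : 𝓞 K) ∉ v.asIdeal) (hpn : p ∣ n)
    {𝔐 : Ideal v.localAbsIntegers} (h𝔐 : 𝔐 ∈ v.localPrimesAbove)
    {σ : absoluteGaloisGroup (v.adicCompletion K)}
    (hσ : σ ∈ 𝔐.inertia (absoluteGaloisGroup (v.adicCompletion K)))
    (P : ((X₀.baseChange (v.adicCompletion K)).baseChange
      (AlgebraicClosure (v.adicCompletion K))).toAffine.Point) (hP : p • P = 0) :
    WeierstrassCurve.Affine.Point.map
      ((absoluteGaloisGroup.toAlgEquiv _ σ :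
          (AlgebraicClosure (v.adicCompletion K)) ≃ₐ[(v.adicCompletion K)]
            (AlgebraicClosure (v.adicCompletion K))) :
        (AlgebraicClosure (v.adicCompletion K)) →ₐ[(v.adicCompletion K)]
          (AlgebraicClosure (v.adicCompletion K))) P = P := by
  revert P hP
  -- the setting, as in `KodairaNeronMultiplicativeProofs`
  set X : WeierstrassCurve (v.adicCompletion K) := X₀.baseChange (v.adicCompletion K) with hXdef
  intro P hP
  letI instDec : DecidableEq (maxUnramified (v.adicCompletion K)) :=
    fun a b => Classical.propDecidable (a = b)
  haveI := isDiscreteValuationRing_unrIntegers hw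
  haveI := henselianLocalRing_unrIntegers hw
  obtain ⟨φ, hφ⟩ := exists_ringHom_adicCompletionIntegers_unrIntegers hw
  obtain ⟨ψ, hψ⟩ := exists_ringHom_unrIntegers_integer (w := w) (v := v) (K := K)
  have hvR := integers_valuationRing_valuation (Valuation.valuationSubring (Valuation.comap
    (algebraMap (maxUnramified (v.adicCompletion K)) (AlgebraicClosure (v.adicCompletion K))) w))
    (maxUnramified (v.adicCompletion K))
  have hinjR := IsFractionRing.injective (Valuation.valuationSubring (Valuation.comap
    (algebraMap (maxUnramified (v.adicCompletion K)) (AlgebraicClosure (v.adicCompletion K))) w))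
    (maxUnramified (v.adicCompletion K))
  have hv0 : w.Integers w.integer := Valuation.integer.integers w
  have hinj0 : Function.Injective (algebraMap w.integer (AlgebraicClosure (v.adicCompletion K))) :=
    hv0.hom_inj
  -- valuations of `p`
  have hpw : w ((p : ℤ) : AlgebraicClosure (v.adicCompletion K)) = 1 :=
    spectralValuation_intCast_eq_one hw (n := (p : ℤ)) (by simpa using hpv)
  have hpL : ((p : ℕ) : AlgebraicClosure (v.adicCompletion K)) ≠ 0 := by
    intro h0
    have : w ((p : ℤ) : AlgebraicClosure (v.adicCompletion K)) = 0 := by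
      rw [Int.cast_natCast, h0, map_zero]
    rw [hpw] at this
    exact one_ne_zero this
  -- `X` is an elliptic curve: `Δ(X₀) = u π^n ≠ 0`
  have hπ0 : π ≠ 0 := hπ.ne_zero
  have hΔ0 : X₀.Δ ≠ 0 := by
    rw [hΔ]; exact mul_ne_zero hu.ne_zero (pow_ne_zero _ hπ0)
  haveI hXell : X.IsElliptic := by
    refine ⟨isUnit_iff_ne_zero.mpr ?_⟩
    change (X₀.map (algebraMap _ _)).Δ ≠ 0
    rw [WeierstrassCurve.map_Δ]
    exact fun h ↦ hΔ0 (IsFractionRing.injective (v.adicCompletionIntegers K) (v.adicCompletion K)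
      (by rw [h, map_zero]))
  -- multiplicative conditions on `X₀`, transferred to `J = X₀ ⊗ 𝒪ⁿʳ`
  have hπm : π ∈ maximalIdeal (v.adicCompletionIntegers K) :=
    (IsLocalRing.mem_maximalIdeal _).mpr hπ.not_isUnit
  have hΔm : X₀.Δ ∈ maximalIdeal (v.adicCompletionIntegers K) := by
    rw [hΔ]
    obtain ⟨k, rfl⟩ : ∃ k, n = k + 1 := ⟨n - 1, by omega⟩
    rw [pow_succ, ← mul_assoc]
    exact Ideal.mul_mem_left _ _ hπm
  set J := X₀.map φ with hJdef
  have hΔI : J.Δ ∈ maximalIdeal (Valuation.valuationSubring (Valuation.comap (algebraMap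
      (maxUnramified (v.adicCompletion K)) (AlgebraicClosure (v.adicCompletion K))) w)) := by
    rw [hJdef, WeierstrassCurve.map_Δ]; exact (map_mem_maximalIdeal_iff hw hφ _).mpr hΔm
  have hc₄I : J.c₄ ∉ maximalIdeal (Valuation.valuationSubring (Valuation.comap (algebraMap
      (maxUnramified (v.adicCompletion K)) (AlgebraicClosure (v.adicCompletion K))) w)) := by
    rw [hJdef, WeierstrassCurve.map_c₄]; exact fun h ↦ hc₄ ((map_mem_maximalIdeal_iff hw hφ _).mp h)
  have hΔI0 : J.Δ ≠ 0 := by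
    rw [hJdef, WeierstrassCurve.map_Δ]
    exact fun h0 ↦ hΔ0 (injective_of_coe_eq_algebraMap hφ (by rw [h0, map_zero]))
  -- (1) Tate normal form over the henselian `𝒪ⁿʳ`; its exponent is `n`; `[J(K_v^nr) : E₀] = n`
  have hsplit := exists_splitNode_root_unrIntegers hw J hΔI hc₄I
  obtain ⟨D, h1, h2, h3, h4, h6⟩ := J.exists_variableChange_eq_tateNormalForm hΔI hc₄I hsplit
  set J' := D • J with hJ'
  have hJ'Δ : J'.Δ ≠ 0 := fun h0 ↦ by
    rw [hJ', WeierstrassCurve.variableChange_Δ, mul_eq_zero] at h0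
    rcases h0 with h0 | h0
    · exact (D.u⁻¹ ^ 12).isUnit.ne_zero (by simpa only [Units.val_pow_eq_pow_val] using h0)
    · exact hΔI0 h0
  have ha0 : J'.a₆ ≠ 0 := fun h0 ↦ by
    apply hJ'Δ
    rw [J'.Δ_eq_of_tateNormalForm h1 h2 h3 h4, h0, zero_mul, neg_zero]
  have hϖ' : Irreducible (φ π) := irreducible_map_of_coe_eq_algebraMap hw hφ hπ
  obtain ⟨m, α, hα⟩ := IsDiscreteValuationRing.eq_unit_mul_pow_irreducible ha0 hϖ'
  have hm1 : 1 ≤ m := by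
    rcases Nat.eq_zero_or_pos m with h0 | hpos
    · exfalso
      rw [h0, pow_zero, mul_one] at hα
      rw [hα] at h6
      exact (IsLocalRing.mem_maximalIdeal _).mp h6 α.isUnit
    · exact hpos
  -- `m = n`: compare the two factorisations of `Δ(J')`
  have hmn : m = n := by
    have hφu : IsUnit (φ u) := (isUnit_map_iff hw hφ u).mpr hu
    have h432 : IsUnit (1 + 432 * J'.a₆) := by
      by_contra hnu
      have hmem : 1 + 432 * J'.a₆ ∈ maximalIdeal _ := (IsLocalRing.mem_maximalIdeal _).mpr hnu
      have h1mem : (1 : Valuation.valuationSubring (Valuation.comap (algebraMap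
          (maxUnramified (v.adicCompletion K)) (AlgebraicClosure (v.adicCompletion K))) w)) ∈
          maximalIdeal _ := by
        have := Ideal.sub_mem _ hmem (Ideal.mul_mem_left _ 432 h6)
        rwa [add_sub_cancel_right] at this
      exact (IsLocalRing.mem_maximalIdeal _).mp h1mem isUnit_one
    have hlhs : J'.Δ = ↑((-1 : (Valuation.valuationSubring (Valuation.comap (algebraMap
        (maxUnramified (v.adicCompletion K)) (AlgebraicClosure (v.adicCompletion K))) w))ˣ) *
        α * h432.unit) * φ π ^ m := by
      rw [J'.Δ_eq_of_tateNormalForm h1 h2 h3 h4]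
      conv_lhs => rw [hα]
      simp only [Units.val_mul, Units.val_neg, Units.val_one, IsUnit.unit_spec]
      conv_rhs => rw [show (1 + 432 * J'.a₆) = (1 + 432 * (↑α * φ π ^ m)) by rw [hα]]
      ring
    have hrhs : J'.Δ = ↑((D.u⁻¹) ^ 12 * hφu.unit) * φ π ^ n := by
      rw [hJ', WeierstrassCurve.variableChange_Δ, hJdef, WeierstrassCurve.map_Δ, hΔ, map_mul,
        map_pow]
      simp only [Units.val_mul, Units.val_pow_eq_pow_val, IsUnit.unit_spec]
      ring
    exact IsDiscreteValuationRing.unit_mul_pow_congr_pow hϖ' hϖ' _ _ m n (hlhs.symm.trans hrhs)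
  have key := LocalIndex.index_eq_of_tateNormalForm (K := (maxUnramified (v.adicCompletion K)))
    J' hϖ' h1 h2 h3 h4 α.isUnit hm1 hα
  rw [hJ', index_nonsingularReductionSubgroup_smul, hmn] at key
  -- so `n • Q ∈ E₀` for every `Q ∈ J(K_v^nr)`
  have hnQ : ∀ Q : (J.baseChange (maxUnramified (v.adicCompletion K))).toAffine.Point,
      J.HasNonsingularReduction (n • Q) := by
    intro Q
    have := (J.nonsingularReductionSubgroup hvR).nsmul_index_mem Q
    rw [key] at this
    exact this
  /- (2) the models `J ⊗ K_v^nr = X ⊗ K_v^nr` and `W₀ = J ⊗ 𝒪_w` with `W₀ ⊗ K̄_v = X ⊗ K̄_v` -/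
  have hX₀K : X₀.baseChange (v.adicCompletion K) = X := rfl
  have hJK : J.baseChange (maxUnramified (v.adicCompletion K)) =
      X.baseChange (maxUnramified (v.adicCompletion K)) := by
    rw [← hX₀K]
    change (X₀.map φ).map (algebraMap _ _) =
      (X₀.map (algebraMap (v.adicCompletionIntegers K) (v.adicCompletion K))).map
        (algebraMap (v.adicCompletion K) (maxUnramified (v.adicCompletion K)))
    rw [WeierstrassCurve.map_map, WeierstrassCurve.map_map]
    congr 1
    refine RingHom.ext fun a ↦ Subtype.ext ?_
    change (((φ a : (Valuation.valuationSubring (Valuation.comap (algebraMap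
      (maxUnramified (v.adicCompletion K)) (AlgebraicClosure (v.adicCompletion K))) w))) :
        (maxUnramified (v.adicCompletion K))) : (AlgebraicClosure (v.adicCompletion K))) =
      ((algebraMap (v.adicCompletion K) (maxUnramified (v.adicCompletion K))
        (algebraMap (v.adicCompletionIntegers K) (v.adicCompletion K) a) :
          (maxUnramified (v.adicCompletion K))) : (AlgebraicClosure (v.adicCompletion K)))
    rw [hφ, IntermediateField.coe_algebraMap_apply]
    rfl
  set W₀ : WeierstrassCurve w.integer := J.map ψ with hW₀def
  have hW₀ : W₀.baseChange (AlgebraicClosure (v.adicCompletion K)) =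
      X.baseChange (AlgebraicClosure (v.adicCompletion K)) := by
    rw [← hX₀K]
    change ((X₀.map φ).map ψ).map (algebraMap _ _) =
      (X₀.map (algebraMap (v.adicCompletionIntegers K) (v.adicCompletion K))).map
        (algebraMap (v.adicCompletion K) (AlgebraicClosure (v.adicCompletion K)))
    rw [WeierstrassCurve.map_map, WeierstrassCurve.map_map, WeierstrassCurve.map_map]
    congr 1
    refine RingHom.ext fun a ↦ ?_
    change ((ψ (φ a) : w.integer) : (AlgebraicClosure (v.adicCompletion K))) =
      algebraMap (v.adicCompletion K) (AlgebraicClosure (v.adicCompletion K))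
        (algebraMap (v.adicCompletionIntegers K) (v.adicCompletion K) a)
    rw [hψ, hφ]
    rfl
  -- the residue field of `𝒪ⁿʳ` embeds into that of `𝒪_w`
  haveI hψloc : IsLocalHom ψ := ⟨fun a ha ↦ by
    by_contra hna
    have hmem : a ∈ maximalIdeal (Valuation.valuationSubring (Valuation.comap (algebraMap
        (maxUnramified (v.adicCompletion K)) (AlgebraicClosure (v.adicCompletion K))) w)) :=
      (IsLocalRing.mem_maximalIdeal _).mpr (mem_nonunits_iff.mpr hna)
    have := (map_mem_maximalIdeal_integer_iff hψ a).mpr hmem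
    exact (mem_nonunits_iff.mp ((IsLocalRing.mem_maximalIdeal _).mp this)) ha⟩
  have hκ : W₀.map (residue w.integer) =
      ((J.map (residue (Valuation.valuationSubring (Valuation.comap (algebraMap
        (maxUnramified (v.adicCompletion K)) (AlgebraicClosure (v.adicCompletion K))) w)))).map
        (IsLocalRing.ResidueField.map ψ)) := by
    rw [hW₀def]
    simp only [WeierstrassCurve.map_map]
    congr 1
  -- the reduction of `W₀` is a node
  have hW₀Δ : IsLocalRing.residue w.integer W₀.Δ = 0 := by
    rw [IsLocalRing.residue_eq_zero_iff, hW₀def, WeierstrassCurve.map_Δ,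
      map_mem_maximalIdeal_integer_iff hψ]
    exact hΔI
  have hW₀c₄ : IsLocalRing.residue w.integer W₀.c₄ ≠ 0 := by
    rw [Ne, IsLocalRing.residue_eq_zero_iff, hW₀def, WeierstrassCurve.map_c₄,
      map_mem_maximalIdeal_integer_iff hψ]
    exact hc₄I
  haveI := henselianRing_integer w
  haveI := isAlgClosed_residueField_integer w
  obtain ⟨r, hrsurj, hr⟩ := W₀.exists_addMonoidHom_units_of_node_of_isAlgClosed hv0 hW₀Δ hW₀c₄
  have hXW : X.baseChange (AlgebraicClosure (v.adicCompletion K)) =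
      W₀.baseChange (AlgebraicClosure (v.adicCompletion K)) := hW₀.symm
  /- (3) the maps on points `J(K_v^nr) ≃ X(K_v^nr) → X(K̄_v)` -/
  set e₁ := WeierstrassCurve.Affine.Point.congrEquiv hJK with he₁
  set ι : (X.baseChange (maxUnramified (v.adicCompletion K))).toAffine.Point →+
      (X.baseChange (AlgebraicClosure (v.adicCompletion K))).toAffine.Point :=
    WeierstrassCurve.Affine.Point.map (W' := X)
      (IsScalarTower.toAlgHom (v.adicCompletion K) (maxUnramified (v.adicCompletion K))
        (AlgebraicClosure (v.adicCompletion K))) with hι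
  have hinjι' : Function.Injective (IsScalarTower.toAlgHom (v.adicCompletion K)
      (maxUnramified (v.adicCompletion K)) (AlgebraicClosure (v.adicCompletion K))) :=
    fun a b hab ↦ Subtype.ext hab
  have hinjι : Function.Injective ι := WeierstrassCurve.Affine.Point.map_injective (W' := X) _
  -- `I_𝔐`-fixed points of `X(K̄_v)` come from `X(K_v^nr)`
  have hsurj : ∀ P : (X.baseChange (AlgebraicClosure (v.adicCompletion K))).toAffine.Point,
      (∀ σ ∈ 𝔐.inertia (absoluteGaloisGroup (v.adicCompletion K)),
        WeierstrassCurve.Affine.Point.map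
          ((absoluteGaloisGroup.toAlgEquiv _ σ : (AlgebraicClosure (v.adicCompletion K))
              ≃ₐ[(v.adicCompletion K)] (AlgebraicClosure (v.adicCompletion K))) :
            (AlgebraicClosure (v.adicCompletion K)) →ₐ[(v.adicCompletion K)]
              (AlgebraicClosure (v.adicCompletion K))) P = P) →
        ∃ Q, ι Q = P := by
    intro P hP
    rcases P with _ | ⟨x, y, h⟩
    · exact ⟨0, map_zero ι⟩
    · have hx : x ∈ (maxUnramified (v.adicCompletion K)) :=
        (mem_maxUnramified_iff_forall_inertia hw h𝔐).mpr fun σ hσ ↦ by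
          have := hP σ hσ
          rw [WeierstrassCurve.Affine.Point.map_some, WeierstrassCurve.Affine.Point.some.injEq] at this
          exact this.1
      have hy : y ∈ (maxUnramified (v.adicCompletion K)) :=
        (mem_maxUnramified_iff_forall_inertia hw h𝔐).mpr fun σ hσ ↦ by
          have := hP σ hσ
          rw [WeierstrassCurve.Affine.Point.map_some, WeierstrassCurve.Affine.Point.some.injEq] at this
          exact this.2
      have h₀ : (X.baseChange (maxUnramified (v.adicCompletion K))).toAffine.Nonsingular
          ⟨x, hx⟩ ⟨y, hy⟩ :=
        (WeierstrassCurve.Affine.baseChange_nonsingular (W := X)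
          (f := IsScalarTower.toAlgHom (v.adicCompletion K) (maxUnramified (v.adicCompletion K))
            (AlgebraicClosure (v.adicCompletion K))) hinjι' ⟨x, hx⟩ ⟨y, hy⟩).mp h
      exact ⟨.some _ _ h₀, rfl⟩
  -- `E₀` of `J` over `𝒪ⁿʳ` maps into `E₀` of `W₀` over `𝒪_w`
  have hE₀ : ∀ Q : (J.baseChange (maxUnramified (v.adicCompletion K))).toAffine.Point,
      J.HasNonsingularReduction Q →
        W₀.HasNonsingularReduction
          (WeierstrassCurve.Affine.Point.congrEquiv hXW (ι (e₁ Q))) := by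
    intro Q hQ
    rcases point_cases hvR Q with rfl | ⟨x, y, h, rfl, hx⟩ | ⟨a, b, h, rfl⟩
    · rw [map_zero, map_zero, map_zero]
      exact WeierstrassCurve.hasNonsingularReduction_zero
    · have hx' : 1 < w (x : (AlgebraicClosure (v.adicCompletion K))) := not_le.mp fun hle ↦
        (not_mem_range_iff hvR).mpr hx
          ⟨⟨x, (Valuation.mem_valuationSubring_iff _ _).mpr hle⟩, rfl⟩
      rw [he₁, WeierstrassCurve.Affine.Point.congrEquiv_some]
      change W₀.HasNonsingularReduction (WeierstrassCurve.Affine.Point.congrEquiv hXW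
        (WeierstrassCurve.Affine.Point.some _ _ _))
      rw [WeierstrassCurve.Affine.Point.congrEquiv_some]
      refine Or.inl ?_
      rw [not_mem_range_iff hv0]
      exact hx'
    · have hns := (WeierstrassCurve.hasNonsingularReduction_some_algebraMap_iff hinjR h).mp hQ
      rw [he₁, WeierstrassCurve.Affine.Point.congrEquiv_some]
      change W₀.HasNonsingularReduction (WeierstrassCurve.Affine.Point.congrEquiv hXW
        (WeierstrassCurve.Affine.Point.some _ _ _))
      rw [WeierstrassCurve.Affine.Point.congrEquiv_some]
      refine Or.inr ⟨ψ a, ψ b, hψ a, hψ b, ?_⟩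
      rw [hκ, ← IsLocalRing.ResidueField.map_residue, ← IsLocalRing.ResidueField.map_residue]
      exact (WeierstrassCurve.Affine.map_nonsingular _
        (IsLocalRing.ResidueField.map ψ).injective _ _).mpr hns
  -- the converse for `K_v^nr`-points: `E₀` of `W₀` pulls back to `E₀` of `J`
  have hE₀' : ∀ Q : (J.baseChange (maxUnramified (v.adicCompletion K))).toAffine.Point,
      W₀.HasNonsingularReduction
          (WeierstrassCurve.Affine.Point.congrEquiv hXW (ι (e₁ Q))) →
        J.HasNonsingularReduction Q := by
    intro Q hQ
    rcases point_cases hvR Q with rfl | ⟨x, y, h, rfl, hx⟩ | ⟨a, b, h, rfl⟩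
    · exact WeierstrassCurve.hasNonsingularReduction_zero
    · exact Or.inl ((not_mem_range_iff hvR).mpr hx)
    · rw [he₁, WeierstrassCurve.Affine.Point.congrEquiv_some] at hQ
      change W₀.HasNonsingularReduction (WeierstrassCurve.Affine.Point.congrEquiv hXW
        (WeierstrassCurve.Affine.Point.some _ _ _)) at hQ
      rw [WeierstrassCurve.Affine.Point.congrEquiv_some] at hQ
      rcases hQ with hxr | ⟨x₀, y₀, hx₀, hy₀, hns⟩
      · exact absurd ⟨ψ a, hψ a⟩ hxr
      · have hx₀' : x₀ = ψ a := hinj0 (hx₀.trans (hψ a).symm)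
        have hy₀' : y₀ = ψ b := hinj0 (hy₀.trans (hψ b).symm)
        subst hx₀' hy₀'
        rw [hκ, ← IsLocalRing.ResidueField.map_residue, ← IsLocalRing.ResidueField.map_residue] at hns
        exact (WeierstrassCurve.hasNonsingularReduction_some_algebraMap_iff hinjR h).mpr
          ((WeierstrassCurve.Affine.map_nonsingular _
            (IsLocalRing.ResidueField.map ψ).injective _ _).mp hns)
  -- `K_v^nr`-points are fixed by the inertia group
  have hfixι : ∀ Q : (X.baseChange (maxUnramified (v.adicCompletion K))).toAffine.Point,
      ∀ τ ∈ 𝔐.inertia (absoluteGaloisGroup (v.adicCompletion K)),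
        WeierstrassCurve.Affine.Point.map
          ((absoluteGaloisGroup.toAlgEquiv _ τ : (AlgebraicClosure (v.adicCompletion K))
              ≃ₐ[(v.adicCompletion K)] (AlgebraicClosure (v.adicCompletion K))) :
            (AlgebraicClosure (v.adicCompletion K)) →ₐ[(v.adicCompletion K)]
              (AlgebraicClosure (v.adicCompletion K))) (ι Q) = ι Q := by
    intro Q τ hτ
    rcases Q with _ | ⟨x, y, h⟩
    · rw [← WeierstrassCurve.Affine.Point.zero_def, map_zero, map_zero]
    · rw [hι, WeierstrassCurve.Affine.Point.map_some, WeierstrassCurve.Affine.Point.map_some,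
        WeierstrassCurve.Affine.Point.some.injEq]
      exact ⟨(mem_maxUnramified_iff_forall_inertia hw h𝔐).mp x.2 τ hτ,
        (mem_maxUnramified_iff_forall_inertia hw h𝔐).mp y.2 τ hτ⟩
  /- (4) Cauchy: a point `R ∈ J(K_v^nr)` whose class modulo `E₀` has order `p` -/
  haveI : Fact p.Prime := ⟨hp⟩
  have hcard : Nat.card ((J.baseChange (maxUnramified (v.adicCompletion K))).toAffine.Point ⧸
      J.nonsingularReductionSubgroup hvR) = n := key
  haveI : Finite ((J.baseChange (maxUnramified (v.adicCompletion K))).toAffine.Point ⧸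
      J.nonsingularReductionSubgroup hvR) := Nat.finite_of_card_ne_zero (by rw [hcard]; omega)
  obtain ⟨g, hg⟩ := exists_prime_addOrderOf_dvd_card'
    (G := (J.baseChange (maxUnramified (v.adicCompletion K))).toAffine.Point ⧸
      J.nonsingularReductionSubgroup hvR) p (by rw [hcard]; exact hpn)
  obtain ⟨R, rfl⟩ := QuotientAddGroup.mk_surjective g
  have hRnot : ¬ J.HasNonsingularReduction R := fun h ↦ by
    have h0 : (QuotientAddGroup.mk R : (J.baseChange (maxUnramified (v.adicCompletion K))).toAffine.Point ⧸
        J.nonsingularReductionSubgroup hvR) = 0 := (QuotientAddGroup.eq_zero_iff R).mpr h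
    rw [h0, addOrderOf_zero] at hg
    exact hp.one_lt.ne' hg.symm
  have hpR : J.HasNonsingularReduction (p • R) := by
    rw [← WeierstrassCurve.mem_nonsingularReductionSubgroup_iff hvR, ← QuotientAddGroup.eq_zero_iff,
      QuotientAddGroup.mk_nsmul, ← hg, addOrderOf_nsmul_eq_zero]
  /- (5) a `p`-torsion point `P₁ ∉ E₀` and a `p`-torsion point `O ≠ T ∈ E₀`, both fixed by `I_𝔐` -/
  have hpw' : w ((p : ℕ) : AlgebraicClosure (v.adicCompletion K)) = 1 := by
    rw [← Int.cast_natCast]; exact hpw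
  set R' : (X.baseChange (AlgebraicClosure (v.adicCompletion K))).toAffine.Point := ι (e₁ R) with hR'
  have hpR' : W₀.HasNonsingularReduction (WeierstrassCurve.Affine.Point.congrEquiv hXW (p • R')) := by
    rw [hR', ← map_nsmul, ← map_nsmul]; exact hE₀ _ hpR
  have hR'not : ¬ W₀.HasNonsingularReduction (WeierstrassCurve.Affine.Point.congrEquiv hXW R') :=
    fun h ↦ hRnot (hE₀' R h)
  obtain ⟨S, hSE₀, hpS, hSfix⟩ := W₀.exists_smul_eq_of_hasNonsingularReduction_of_node hXW r hrsurj
    hr hp hpw' (p • R') hpR'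
  obtain ⟨T, hT0, hpT, hTE₀, hTfix⟩ := W₀.exists_torsion_hasNonsingularReduction_of_node hXW r
    hrsurj hr hp hpw'
  set P₁ : (X.baseChange (AlgebraicClosure (v.adicCompletion K))).toAffine.Point := R' - S with hP₁
  have hpP₁ : p • P₁ = 0 := by rw [hP₁, nsmul_sub, hpS, sub_self]
  have hP₁not : ¬ W₀.HasNonsingularReduction (WeierstrassCurve.Affine.Point.congrEquiv hXW P₁) := by
    intro h
    apply hR'not
    have : R' = P₁ + S := by rw [hP₁, sub_add_cancel]
    rw [this, map_add]
    exact (W₀.nonsingularReductionSubgroup hv0).add_mem h hSE₀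
  /- (6) the subgroup of `X(K̄_v)[p]` fixed by `σ` contains `T` and `P₁`, hence everything -/
  obtain ⟨hσ₁, hσ₂⟩ := WeierstrassCurve.isometry_of_mem_inertia hw h𝔐 hσ
  set σ' : (AlgebraicClosure (v.adicCompletion K)) →ₐ[(v.adicCompletion K)]
      (AlgebraicClosure (v.adicCompletion K)) :=
    ((absoluteGaloisGroup.toAlgEquiv _ σ : (AlgebraicClosure (v.adicCompletion K))
        ≃ₐ[(v.adicCompletion K)] (AlgebraicClosure (v.adicCompletion K))) :
      (AlgebraicClosure (v.adicCompletion K)) →ₐ[(v.adicCompletion K)]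
        (AlgebraicClosure (v.adicCompletion K))) with hσ'
  have hσR' : WeierstrassCurve.Affine.Point.map σ' R' = R' := hfixι (e₁ R) σ hσ
  have hσpR' : WeierstrassCurve.Affine.Point.map σ' (p • R') = p • R' := by rw [map_nsmul, hσR']
  have hσS : WeierstrassCurve.Affine.Point.map σ' S = S := hSfix σ' hσ₁ hσ₂ hσpR'
  have hσT : WeierstrassCurve.Affine.Point.map σ' T = T := hTfix σ' hσ₁ hσ₂
  have hσP₁ : WeierstrassCurve.Affine.Point.map σ' P₁ = P₁ := by rw [hP₁, map_sub, hσR', hσS]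
  set H := WeierstrassCurve.torsionPoints X (AlgebraicClosure (v.adicCompletion K)) p with hHdef
  have hcardH : Nat.card H = p ^ 2 :=
    WeierstrassCurve.card_torsionPoints_eq_sq_holds X (AlgebraicClosure (v.adicCompletion K)) hpL
  have hmemH : ∀ Z : (X.baseChange (AlgebraicClosure (v.adicCompletion K))).toAffine.Point,
      p • Z = 0 → Z ∈ H := fun Z hZ ↦ by
    rw [hHdef, WeierstrassCurve.mem_torsionPoints_iff, natCast_zsmul]; exact hZ
  set E := (W₀.nonsingularReductionSubgroup hv0).comap
    (WeierstrassCurve.Affine.Point.congrEquiv hXW).toAddMonoidHom with hEdef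
  set F := AddMonoidHom.eqLocus (WeierstrassCurve.Affine.Point.map σ' :
      (X.baseChange (AlgebraicClosure (v.adicCompletion K))).toAffine.Point →+
        (X.baseChange (AlgebraicClosure (v.adicCompletion K))).toAffine.Point)
    (AddMonoidHom.id _) with hFdef
  have hle : H ≤ F :=
    addSubgroup_le_of_card_eq_sq hp (H := H) (E := E) (F := F) hcardH (hmemH T hpT) (hmemH P₁ hpP₁)
      hT0 hpT (by rw [hEdef, AddSubgroup.mem_comap]; exact hTE₀)
      (by rw [hEdef, AddSubgroup.mem_comap]; exact hP₁not) hσT hσP₁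
  exact hle (hmemH P hP)

end IsDedekindDomain.HeightOneSpectrum

/-! ## The theorem for an elliptic curve over a number field at a multiplicative place -/

namespace WeierstrassCurve

open Literature.NumberTheory.EllipticCurves Literature.NumberTheory.GaloisRepresentations Field
  IsDedekindDomain.HeightOneSpectrum

variable {K : Type u} [Field K] [NumberField K] {v : HeightOneSpectrum (𝓞 K)}
  (W : WeierstrassCurve K)

/-- **Tate-curve criterion, unramified direction, for `E/K` at a multiplicative place.**  Let
`E/K` be an elliptic curve over a number field, `v` a finite place of multiplicative reduction,
`p` a prime with `v ∤ p` and `p ∣ ord_v(Δ_min)` (`WeierstrassCurve.ordMinimalDiscriminant`), `𝔐`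
the prime of `\bar 𝓞_v` above `𝓂_v` and `τ ∈ I_𝔐 ≤ Γ_{K_v}`.  Then `τ` fixes every
`P ∈ E(K̄_v)` with `p P = O`: "`E[p]` is unramified at `v`" (Serre, Invent. Math. 15 (1972),
n° 1.12; Serre, Duke Math. J. 54 (1987), (4.1.12); Diamond–Darmon–Taylor, *Fermat's Last Theorem*,
Prop. 2.12(c); Silverman, *ATAEC*, Exercise 5.13(b)).  Proof: on the integral minimal model `X₀`
at `v` one has `c₄ ∈ 𝓞_v^×`, `Δ(X₀) = α π^m` with `m = ord_v(Δ_min) ≥ 1`; apply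
`IsDedekindDomain.HeightOneSpectrum.forall_inertia_map_eq_of_multiplicative_of_dvd` and transport
along `E(K̄_v) ≃ X₀(K̄_v)` (`exists_addEquiv_localPoints_of_smul_eq`).
[cite: SerreInventiones1972, n° 1.12] [cite: Serre1987, §4.1 (4.1.12)]
[cite: SilvermanATAEC1994, Cor. IV.9.2(d), V.4–V.5 and Exercise 5.13(b) (PDF p. 416)] -/
theorem smul_eq_of_mem_inertia_of_hasMultiplicativeReductionAt_of_dvd [W.IsElliptic]
    (hmult : W.HasMultiplicativeReductionAt v) {p : ℕ} (hp : p.Prime)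
    (hpv : (p : 𝓞 K) ∉ v.asIdeal) (hdvd : p ∣ W.ordMinimalDiscriminant v)
    {w : Valuation (AlgebraicClosure (v.adicCompletion K)) ℝ≥0}
    (hw : ∀ x, (w x : ℝ) =
      spectralNorm (v.adicCompletion K) (AlgebraicClosure (v.adicCompletion K)) x)
    {𝔐 : Ideal v.localAbsIntegers} (h𝔐 : 𝔐 ∈ v.localPrimesAbove)
    {τ : absoluteGaloisGroup (v.adicCompletion K)}
    (hτ : τ ∈ 𝔐.inertia (absoluteGaloisGroup (v.adicCompletion K)))
    (P : localPoints W (v.adicCompletion K)) (hP : p • P = 0) : τ • P = P := by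
  -- the integral minimal model `X₀` at `v`
  set X := W.localMinimalModel v with hXdef
  haveI : X.IsElliptic := W.isElliptic_localMinimalModel v
  have hmult' : X.HasMultiplicativeReduction (v.adicCompletionIntegers K) := hmult
  set X₀ : WeierstrassCurve (v.adicCompletionIntegers K) :=
    X.integralModel (v.adicCompletionIntegers K) with hX₀
  have hX₀X : X₀.baseChange (v.adicCompletion K) = X :=
    baseChange_integralModel_eq (v.adicCompletionIntegers K) X
  -- `Δ(X₀) ∈ 𝔪_v`, `c₄(X₀) ∈ 𝓞_v^×`
  have hΔm : X₀.Δ ∈ IsLocalRing.maximalIdeal (v.adicCompletionIntegers K) := by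
    have h := hmult'.badReduction
    rw [← integralModel_Δ_eq (v.adicCompletionIntegers K) X] at h
    exact (valuation_lt_one_iff_mem _ _).mp h
  have hc₄ : X₀.c₄ ∉ IsLocalRing.maximalIdeal (v.adicCompletionIntegers K) := by
    have h := hmult'.multiplicativeReduction
    rw [← integralModel_c₄_eq (v.adicCompletionIntegers K) X, valuation_of_algebraMap] at h
    exact intValuation_eq_one_iff.mp h
  -- `Δ(X₀) = α π^m`, `m = ord_v(Δ_min) ≥ 1`
  obtain ⟨π, hπ⟩ := IsDiscreteValuationRing.exists_irreducible (v.adicCompletionIntegers K)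
  have hΔ0 : X₀.Δ ≠ 0 := by
    intro h0
    apply X.isUnit_Δ.ne_zero
    rw [← hX₀X]
    change (X₀.map _).Δ = 0
    rw [map_Δ, h0, map_zero]
  obtain ⟨m, α, hα⟩ := IsDiscreteValuationRing.eq_unit_mul_pow_irreducible hΔ0 hπ
  have hm : W.ordMinimalDiscriminant v = m := by
    change (IsDiscreteValuationRing.addVal (v.adicCompletionIntegers K) X₀.Δ).toNat = m
    rw [IsDiscreteValuationRing.addVal_def X₀.Δ α hπ m hα]
    rfl
  have hm1 : 1 ≤ m := by
    rcases Nat.eq_zero_or_pos m with h0 | hpos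
    · exfalso
      rw [h0, pow_zero, mul_one] at hα
      rw [hα] at hΔm
      exact (IsLocalRing.mem_maximalIdeal _).mp hΔm α.isUnit
    · exact hpos
  rw [hm] at hdvd
  -- transport `E(K̄_v) ≃ X₀(K̄_v)` and the local theorem
  obtain ⟨C, hC⟩ := W.exists_variableChange_smul_eq_localMinimalModel v
  have hC' : C • W.baseChange (v.adicCompletion K) = X₀.baseChange (v.adicCompletion K) := by
    rw [hC, hX₀X]
  obtain ⟨Φ, hΦ⟩ := W.exists_addEquiv_localPoints_of_smul_eq v hC'
  have hΦP : p • Φ P = 0 := by rw [← map_nsmul, hP, map_zero]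
  have key := forall_inertia_map_eq_of_multiplicative_of_dvd hw X₀ α.isUnit hπ hm1 hα hc₄ hp hpv
    hdvd h𝔐 hτ (Φ P) hΦP
  apply Φ.injective
  rw [hΦ]
  exact key

open scoped Pointwise in
/-- **`E[p]` is unramified at a multiplicative place `v ∤ p` with `p ∣ ord_v(Δ_min)`, for the
global inertia group.**  Let `E/K` be an elliptic curve over a number field, `v` a finite place of
multiplicative reduction, `p` a prime with `v ∤ p` and `p ∣ ord_v(Δ_min)`, `𝔓` a prime of
`\bar ℤ_K` above `v` and `τ ∈ I_𝔓 ≤ Gal(K̄/K)`.  Then `τ` fixes every `P ∈ E(K̄)` with `p P = O`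
(Serre 1972, n° 1.12; Serre 1987, (4.1.12): the primes `ℓ ≠ p` with `p ∣ v_ℓ(Δ)` do not divide the
conductor of `ρ̄_{E,p}`).  From the local statement
`smul_eq_of_mem_inertia_of_hasMultiplicativeReductionAt_of_dvd` by lifting `τ` to the local inertia
group along an embedding `K̄ → K̄_v` cutting out `𝔓` (Neukirch, *ANT* II (9.6),
`exists_mem_inertia_apply_eq_holds`; the glue of `smul_geomPoints_eq_of_mem_inertia`).
[cite: SerreInventiones1972, n° 1.12] [cite: Serre1987, §4.1 (4.1.12)] [cite: NeukirchANT1999, Ch. II §9 Prop. (9.6)] -/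
theorem smul_eq_of_mem_inertia_of_hasMultiplicativeReductionAt_of_dvd_of_nsmul_eq_zero
    [W.IsElliptic] (hmult : W.HasMultiplicativeReductionAt v) {p : ℕ} (hp : p.Prime)
    (hpv : (p : 𝓞 K) ∉ v.asIdeal) (hdvd : p ∣ W.ordMinimalDiscriminant v)
    {𝔓 : Ideal (absIntegers (𝓞 K) K)} (h𝔓 : 𝔓 ∈ v.primesAbove)
    {τ : absoluteGaloisGroup K} (hτ : τ ∈ 𝔓.inertia (absoluteGaloisGroup K))
    {P : geomPoints W} (hP : p • P = 0) : τ • P = P := by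
  obtain ⟨w, hw⟩ := v.exists_spectralValuation
  obtain ⟨𝔐, h𝔐⟩ := v.localPrimesAbove_nonempty
  -- arrange `𝔓 = 𝔓_{ι,𝔐}` for an embedding `ι : K̄ → K̄_v`
  obtain ⟨g, hg⟩ := HeightOneSpectrum.exists_smul_eq_of_mem_primesAbove_holds
    (HeightOneSpectrum.primeBelow_mem_primesAbove
      (ι := closureEmb (K := K) (v.adicCompletion K)) h𝔐) h𝔓
  set ι : AlgebraicClosure K →ₐ[K] AlgebraicClosure (v.adicCompletion K) :=
    (closureEmb (K := K) (v.adicCompletion K)).comp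
      ((show AlgebraicClosure K ≃ₐ[K] AlgebraicClosure K from g⁻¹) :
        AlgebraicClosure K →ₐ[K] AlgebraicClosure K) with hι
  have h1 : 𝔓 = v.primeBelow ι 𝔐 := by
    rw [hι, HeightOneSpectrum.primeBelow_comp, ← hg]
    exact congrArg (· • _) (inv_inv g).symm
  rw [h1] at hτ
  -- lift `τ ∈ I_𝔓` to the local inertia group `I_𝔐 ≤ Γ_{K_v}`
  obtain ⟨σ, hσI, hσ⟩ :=
    IsDedekindDomain.HeightOneSpectrum.exists_mem_inertia_apply_eq_holds v ι h𝔐 hτ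
  have hres : resGalOfEmb ι σ = τ := resGalOfEmb_eq_of_apply_eq ι hσ
  have hequiv : pointsMapOfEmb W ι (τ • P) = σ • pointsMapOfEmb W ι P := by
    rw [← hres]
    exact pointsMapOfEmb_smul W ι σ P
  have hfix : σ • pointsMapOfEmb W ι P = pointsMapOfEmb W ι P :=
    W.smul_eq_of_mem_inertia_of_hasMultiplicativeReductionAt_of_dvd hmult hp hpv hdvd hw h𝔐 hσI
      (pointsMapOfEmb W ι P) (by rw [← map_nsmul, hP, map_zero])
  exact pointsMapOfEmb_injective W ι (hequiv.trans hfix)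

/-- The same on the `Γ_K`-module `E[n] = geomTorsion W n` for `n = p`: the inertia group of any
prime above a multiplicative place `v ∤ p` with `p ∣ ord_v(Δ_min)` acts trivially on the
`p`-torsion (Serre 1972, n° 1.12; Serre 1987, (4.1.12)). [cite: SerreInventiones1972, n° 1.12] [cite: Serre1987, §4.1 (4.1.12)] -/
theorem smul_geomTorsion_eq_of_mem_inertia_of_hasMultiplicativeReductionAt_of_dvd [W.IsElliptic]
    (hmult : W.HasMultiplicativeReductionAt v) {p : ℕ} (hp : p.Prime)
    (hpv : (p : 𝓞 K) ∉ v.asIdeal) (hdvd : p ∣ W.ordMinimalDiscriminant v)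
    {𝔓 : Ideal (absIntegers (𝓞 K) K)} (h𝔓 : 𝔓 ∈ v.primesAbove)
    {τ : absoluteGaloisGroup K} (hτ : τ ∈ 𝔓.inertia (absoluteGaloisGroup K))
    (P : geomTorsion W (p : ℤ)) : τ • P = P :=
  Subtype.ext <| by
    rw [AddSubgroup.torsionBy.coe_smul]
    refine W.smul_eq_of_mem_inertia_of_hasMultiplicativeReductionAt_of_dvd_of_nsmul_eq_zero hmult
      hp hpv hdvd h𝔓 hτ ?_
    rw [← natCast_zsmul]
    exact (Submodule.mem_torsionBy_iff (p : ℤ) P.1).mp P.2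

end WeierstrassCurve

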